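import Summits.FinalStateConjecture.FinalStateConjecture.Theses.BartnikGapSettling
import Summits.FinalStateConjecture.FinalStateConjecture.Theorems.GapExhaustion.Negative.GapExhaustionFalseOfFarWildBlackHole
import Summits.FinalStateConjecture.FinalStateConjecture.Theorems.BartnikGapSettlingGapExhaustionOfJunkCollars
import Literature.Geometry.Lorentzian.NearKerrCollarCore
import Literature.Geometry.Lorentzian.CollarMargin

/-!
# `GapExhaustion` (stmt-FinalStateConjecture-10808) — crux-strategist s2: typed companion of
# `STRATEGY-CENSUS.md` (2026-08-17, second strategist pass)

Scratch file of the crux-strategist seat `planner-cstrat-stmt-FinalStateConjecture-10808-s2-0`;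
NOT a proposal, NOT a statement item, NOT a registrable line (no `GapExhaustion_of`, no `stub_*`).
It adds to `RESTATED_s1.lean` (s1's companion, same directory) three typed artefacts the census
refers to:

* §1 **readable per-development form of the FILED decl** — `FiledAt 𝒟` over the landed notions
  `Spacetime.CollarMargin` (p-landed, `CollarMargin.lean`) and `NearKerrCollarCore` (D2,
  `NearKerrCollarCore.lean`), with `gapExhaustion_iff_filedAt : GapExhaustion ↔ ∀ …, FiledAt 𝒟`
  by `Iff.rfl` — the two Literature docstrings promise exactly this agreement; here it is
  kernel-checked once, so later seats can reason about the filed text clause by clause.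
* §2 **`## Decomposition` (filed text): the far-field SECTOR split** —
  `GapExhaustion ↔ FarRegularSector ∧ FarWildSector` (`gapExhaustion_iff_sectors`), the
  far-regular sector implied by junk charts ON FAR-REGULAR DATA ONLY
  (`farRegularSector_of_junkOnFarRegular`: the uncontroversial half of `ExtremalJunkCollars`),
  and `FarWildBlackHoleExists → ¬ (FarRegularSector ∧ FarWildSector)`. Reading: the filed item is
  the conjunction of a sector that is TRUE FOR THE WRONG REASON and a sector that is FALSE ON
  PAPER; no piece of any split of the filed text carries the intended dynamics.
* §3 **`## Strengthen`: the Lyapunov form `LyapunovExhaustion`** as a signature (a settling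
  functional on cores, antitone along causal nesting, exhausted beyond compact sets, dominating
  the own-energy excess of windowed `δ`-collared cores), with the one-line reason it buys nothing
  recorded in its docstring and in the census.

Nothing here asserts the truth of any item; every theorem is logic over landed declarations.
-/

noncomputable section

-- D-0017: single-problem summit, `Summit.<S>.<S>.…` by design (cf. lakefile `weak.linter.dupNamespace`).
set_option linter.dupNamespace false

namespace Summit.FinalStateConjecture.FinalStateConjecture.Cruxes.GapExhaustion.StrategyS2

open Literature.Geometry.Lorentzian
open Set Filter Topology
open scoped Manifold ContDiff Topology ENNReal BigOperators

open Summit.FinalStateConjecture.FinalStateConjecture.Theses.BartnikGapSettling (GapExhaustion)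
open Summit.FinalStateConjecture.FinalStateConjecture.Theorems
  (not_hasCollarMargin_of_junkChart)
open Summit.FinalStateConjecture.FinalStateConjecture.Theorems.GapExhaustion.Negative
  (FarWildBlackHoleExists GapExhaustion_false_of_farWildBlackHoleExists)

/-! ## §1 The filed decl, development by development, over the landed notions -/

section Filed

variable {X : Type} [TopologicalSpace X] [ChartedSpace E3 X] [IsManifold (𝓡 3) ∞ X]
  [ConnectedSpace X] {D : InitialDataSet (𝓡 3) X}

/-- **The conclusion of the filed `GapExhaustion` owed by one development `𝒟`**, written over
`CauchyDevelopment.IsNearKerrLeaf` and `VacuumCauchyDevelopment.NearKerrCollarCore` (the tail of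
the filed conjunction, (C1)–(C7)): hole bound `N₀`, window `m₀`, margin `χ`, then for every order
`k` a geometry bound `Λ < ⊤`, then for every collar tolerance `δ`, gap `γ` and compact `K` a late
`(Λ,k)`-leaf with `N ≤ N₀` windowed margined holes, a probe point and a `δ`-collared core of
Bondi–Bartnik gap `≤ γ`. [folklore] -/
def FiledConclusion (𝒟 : VacuumCauchyDevelopment D) : Prop :=
  ∃ (N₀ : ℕ) (m₀ χ : ℝ), 0 < m₀ ∧ χ < 1 ∧ ∀ k : ℕ, ∃ Λ : ℝ≥0∞, Λ < ⊤ ∧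
    ∀ (δ : ℝ≥0∞) (γ : ℝ), 0 < δ → 0 < γ → ∀ K : Set 𝒟.carrier, IsCompact K →
      ∃ (N : ℕ) (M a : Fin N → ℝ) (S : Set 𝒟.carrier) (p : 𝒟.carrier)
        (mo' : Fin N → lorentzGroup × E4) (B' : Fin N → ModelBackground)
        (Φ : ∀ i, (B' i).domain → 𝒟.carrier),
        N ≤ N₀ ∧ (∀ i, m₀ ≤ M i ∧ M i ≤ m₀⁻¹ ∧ |a i| ≤ χ * M i) ∧
        𝒟.toCauchyDevelopment.IsNearKerrLeaf k Λ N M a S ∧ p ∈ S ∧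
        Disjoint (𝒟.metric.causalFuture 𝒟.timeOrientation S)
          (𝒟.metric.causalPast 𝒟.timeOrientation K) ∧
        𝒟.NearKerrCollarCore k δ γ N M a S p mo' B' Φ

/-- **The filed item at one development**: maximal → complete `𝓘⁺` (sojourn form) → the
UNWINDOWED collar margin (`Spacetime.CollarMargin`) → `FiledConclusion`. [folklore] -/
def FiledAt (𝒟 : VacuumCauchyDevelopment D) : Prop :=
  𝒟.IsMaximal → Summit.FinalStateConjecture.HasCompleteNullInfinity 𝒟.toCauchyDevelopment →
    𝒟.CollarMargin → FiledConclusion 𝒟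

end Filed

/-- **The filed `GapExhaustion` is, definitionally, `∀ admissible D, ∀ 𝒟, FiledAt 𝒟`.** The
docstrings of `CollarMargin.lean` and `NearKerrCollarCore.lean` promise this `Iff.rfl`; it is
checked here. [folklore] -/
theorem gapExhaustion_iff_filedAt :
    GapExhaustion ↔
      ∀ (X : Type) [TopologicalSpace X] [ChartedSpace E3 X] [IsManifold (𝓡 3) ∞ X]
        [T2Space X] [SecondCountableTopology X] [ConnectedSpace X],
        ∀ D ∈ admissibleVacuumData X, ∀ 𝒟 : VacuumCauchyDevelopment D, FiledAt 𝒟 :=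
  Iff.rfl

/-! ## §2 `## Decomposition` of the census — the far-field sector split of the FILED text -/

section Sectors

variable {X : Type} [TopologicalSpace X] [ChartedSpace E3 X] [IsManifold (𝓡 3) ∞ X]
  [ConnectedSpace X]

/-- **R7: far-regular data** (verbatim `RestatedS1.IsFarRegular`, which a crux workfile cannot
import): strongly asymptotically flat at the Dafermos–Rodnianski rates to EVERY derivative order on
a sole end. Admissibility gives order `(2, 1)` only. [folklore] -/
def IsFarRegular (D : InitialDataSet (𝓡 3) X) : Prop :=
  ∀ n : ℕ, ∃ (e : AFEnd X) (M : ℝ), e.IsSoleEnd ∧ e.IsStronglyAsymptoticallyFlatWith D M 1 2 n n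

end Sectors

/-- **Far-regular sector of the filed text**: the filed item restricted to far-regular data. On
paper this sector is TRUE FOR THE WRONG REASON — far-regular developments carry extremal junk
collar charts at every tolerance in their far/near-flat regions, so the unwindowed margin
hypothesis is never met (`farRegularSector_of_junkOnFarRegular`). -/
def FarRegularSector : Prop :=
  ∀ (X : Type) [TopologicalSpace X] [ChartedSpace E3 X] [IsManifold (𝓡 3) ∞ X]
    [T2Space X] [SecondCountableTopology X] [ConnectedSpace X],
    ∀ D ∈ admissibleVacuumData X, IsFarRegular D → ∀ 𝒟 : VacuumCauchyDevelopment D, FiledAt 𝒟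

/-- **Far-wild sector of the filed text**: the filed item restricted to admissible data that are
NOT far-regular (`C²`-quiet, `Cⁿ`-wild tails for some `n ≥ 3`). On paper this sector is FALSE: the
witness of `FarWildBlackHoleExists` (off-focus hole + generic far-wild `C³` tail, ADDENDUM-c2 §3)
lives here, its margin hypothesis holds honestly-vacuously at order `3` and the `k = 3` conclusion
fails (p108531). -/
def FarWildSector : Prop :=
  ∀ (X : Type) [TopologicalSpace X] [ChartedSpace E3 X] [IsManifold (𝓡 3) ∞ X]
    [T2Space X] [SecondCountableTopology X] [ConnectedSpace X],
    ∀ D ∈ admissibleVacuumData X, ¬ IsFarRegular D → ∀ 𝒟 : VacuumCauchyDevelopment D, FiledAt 𝒟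

/-- **The sector split is exact**: the filed item is the conjunction of its two sectors (excluded
middle on `IsFarRegular D`). This is the best HONEST typed split of the filed text the seat could
produce — and it is not fileable: one piece is content-free, the other believed false. [folklore] -/
theorem gapExhaustion_iff_sectors : GapExhaustion ↔ FarRegularSector ∧ FarWildSector := by
  rw [gapExhaustion_iff_filedAt]
  constructor
  · intro h
    exact ⟨fun X _ _ _ _ _ _ D hD _ 𝒟 => h X D hD 𝒟, fun X _ _ _ _ _ _ D hD _ 𝒟 => h X D hD 𝒟⟩
  · rintro ⟨hR, hW⟩ X _ _ _ _ _ _ D hD 𝒟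
    by_cases hfr : IsFarRegular D
    · exact hR X D hD hfr 𝒟
    · exact hW X D hD hfr 𝒟

/-- **The far-regular sector modulo junk charts on far-regular data only.** `hJ` is the body of
`ExtremalJunkCollars` (sibling Negative module of crux 10809, p103863) with the extra hypothesis
`IsFarRegular D` — the UNCONTROVERSIAL half of that construction hypothesis (degree-`0` homogeneity
of Kerr–Schild at labels `M₁ → ∞` plus a smooth `ε`-isometric corrugated spacelike embedding of
the rescaled extremal Kerr-star slab in a far near-flat region, Boukholkhal arXiv:2407.19333
Prop. 3.1 / Thm. 1.2; on far-WILD data it fails at order `k₁ ≥ 3`). Under it every far-regular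
development lacks a collar margin, so the sector holds vacuously. [folklore] -/
theorem farRegularSector_of_junkOnFarRegular
    (hJ : ∀ (X : Type) [TopologicalSpace X] [ChartedSpace E3 X] [IsManifold (𝓡 3) ∞ X]
      [T2Space X] [SecondCountableTopology X] [ConnectedSpace X],
      ∀ D ∈ admissibleVacuumData X, IsFarRegular D → ∀ 𝒟 : VacuumCauchyDevelopment D,
        𝒟.IsMaximal → ∀ (k₁ : ℕ) (δ₁ : ℝ≥0∞) (K₁ : Set 𝒟.carrier), 0 < δ₁ → IsCompact K₁ →
          ∃ (M₁ : ℝ) (mo₁ : lorentzGroup × E4) (B₁ : ModelBackground)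
            (Φ₁ : B₁.domain → 𝒟.carrier),
            0 < M₁ ∧
            B₁ = starBackground mo₁.1 mo₁.2 M₁ M₁
              (fun x => Kerr.radius M₁ (poincareInv mo₁.1 mo₁.2 x)) ∧
            ContMDiffOn 𝓘(ℝ, E4) (𝓡 4) ∞ Φ₁
              {x | -1 < B₁.time x.1 ∧ B₁.time x.1 < 1 ∧ B₁.radius x.1 < 3 * M₁ + 1} ∧
            Topology.IsOpenEmbedding
              ({x | -1 < B₁.time x.1 ∧ B₁.time x.1 < 1 ∧ B₁.radius x.1 < 3 * M₁ + 1}.restrict Φ₁) ∧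
            𝒟.toSpacetime.truncDeviationCk B₁ Φ₁ k₁ (3 * M₁) 0 ≤ δ₁ ∧
            Disjoint (Φ₁ '' B₁.truncTimeSlab (3 * M₁) 0)
              (𝒟.metric.causalPast 𝒟.timeOrientation K₁)) :
    FarRegularSector := by
  intro X _ _ _ _ _ _ D hD hfr 𝒟 hmax _ hcm
  exfalso
  obtain ⟨χ₁, k₁, δ₁, K₁, hχ₁, hδ₁, hK₁, hm⟩ := hcm
  obtain ⟨M₁, mo₁, B₁, Φ₁, hM₁, hB, hsm, hemb, hdev, hdisj⟩ :=
    hJ X D hD hfr 𝒟 hmax k₁ δ₁ K₁ hδ₁ hK₁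
  exact not_hasCollarMargin_of_junkChart 𝒟.toSpacetime χ₁ k₁ δ₁ K₁ M₁ M₁ mo₁ B₁ Φ₁ hM₁
    (abs_of_pos hM₁).le (by rw [abs_of_pos hM₁]; nlinarith) hB hsm hemb hdev hdisj hm

/-- **Modulo `FarWildBlackHoleExists` the two sectors do not both hold** (p108531 through the
split). With `farRegularSector_of_junkOnFarRegular` this pins the believed-false content of the
filed text to the far-WILD sector: junk-on-far-regular and the far-wild black hole are both
expected on paper, they concern DIFFERENT sectors, and together they make the filed item false —
not merely "decided by bookkeeping". [folklore] -/
theorem not_sectors_of_farWildBlackHoleExists (H : FarWildBlackHoleExists) :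
    ¬ (FarRegularSector ∧ FarWildSector) := fun h =>
  GapExhaustion_false_of_farWildBlackHoleExists H (gapExhaustion_iff_sectors.2 h)

/-- Corollary recorded for the census: under junk-on-far-regular AND the far-wild black hole, the
far-wild sector alone is refuted — the exact location of the misstatement. [folklore] -/
theorem farWildSector_false (hR : FarRegularSector) (H : FarWildBlackHoleExists) :
    ¬ FarWildSector := fun hW =>
  not_sectors_of_farWildBlackHoleExists H ⟨hR, hW⟩

/-! ## §3 `## Strengthen` of the census — the Lyapunov (LaSalle) form, as a signature -/

/-- **S⁺₃ `LyapunovExhaustion`** — the rigid form of the crux's energy half that "admits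
induction": on every maximal far-regular development with complete `𝓘⁺` there is a SETTLING
FUNCTIONAL `L` on cores which is (i) antitone along causal nesting (a Lyapunov function of the
Einstein flow read on cores), (ii) exhausted beyond compact sets, and (iii) coercive: it dominates
the own-energy excess `m − Σ Mᵢ` of every windowed `δ`-collared `N ≤ 1` core (the collar block
(C1)–(C6) of `NearKerrCollarCore`, gap clause unused: `γ` is instantiated at `0` only to name the
block; the coercivity is asked for `δ ≤ δ'`). (i)+(ii)+(iii) give the own-energy exhaustion of the
restated crux at once (`OwnEnergyExhaustion` of `RESTATED_s1.lean`), and (i) makes limits exist.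
WHY IT BUYS NOTHING FOR THIS STEP (census `## Strengthen`): the only candidate `L` the theory
offers non-perturbatively is the Bondi energy excess itself ((i) = mass loss, printed for CK /
Bondi–Sachs spacetimes only; (iii) = identity), for which (ii) IS the crux; every other candidate
(an integrated Morawetz/red-shift energy through `J⁺` of the core) is finite for LARGE data only
given a priori control of trapping of the unknown late geometry — the point where the transfer from
the spherically symmetric sibling breaks (Dafermos–Rodnianski, Invent. Math. 162 (2005), Prop. 4.1:
two-sided monotonicity of the Hawking mass is the symmetry's gift) and where the catalogued
barrier `TrappingDerivativeLoss` and Keir's stable-trapping theorem (CQG 33 (2016), Thm. 4.7) sit.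
Monotone and bounded gives `lim L`, never `lim L = 0`. Typed for the census; not filed. -/
def LyapunovExhaustion : Prop :=
  ∀ (X : Type) [TopologicalSpace X] [ChartedSpace E3 X] [IsManifold (𝓡 3) ∞ X] [T2Space X]
    [SecondCountableTopology X] [ConnectedSpace X], ∀ D ∈ admissibleVacuumData X,
    IsFarRegular D → ∀ 𝒟 : VacuumCauchyDevelopment D, 𝒟.IsMaximal →
      Summit.FinalStateConjecture.HasCompleteNullInfinity 𝒟.toCauchyDevelopment →
      ∀ (m₀ χ : ℝ) (k : ℕ), 0 < m₀ → χ < 1 →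
        ∃ (L : Set 𝒟.carrier → ℝ≥0∞) (δ' : ℝ≥0∞), 0 < δ' ∧
          (∀ C C' : Set 𝒟.carrier,
            C' ⊆ 𝒟.metric.causalFuture 𝒟.timeOrientation C → L C' ≤ L C) ∧
          (∀ γ : ℝ, 0 < γ → ∃ K : Set 𝒟.carrier, IsCompact K ∧
            ∀ C : Set 𝒟.carrier,
              Disjoint (𝒟.metric.causalFuture 𝒟.timeOrientation C)
                (𝒟.metric.causalPast 𝒟.timeOrientation K) → L C ≤ ENNReal.ofReal γ) ∧
          (∀ (δ : ℝ≥0∞) (N : ℕ) (M a : Fin N → ℝ) (S : Set 𝒟.carrier) (p : 𝒟.carrier)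
            (mo : Fin N → lorentzGroup × E4) (B : Fin N → ModelBackground)
            (Φ : ∀ i, (B i).domain → 𝒟.carrier) (m : ℝ), δ ≤ δ' → N ≤ 1 →
            (∀ i, m₀ ≤ M i ∧ M i ≤ m₀⁻¹ ∧ |a i| ≤ χ * M i) →
            (∀ i, p ∈ Φ i '' (B i).truncTimeSlab (3 * M i) 0) →
            𝒟.NearKerrCollarCore k δ 0 N M a S p mo B Φ →
            𝒟.toCauchyDevelopment.HasCutBondiMass (collarCore M p B Φ) m →
            ENNReal.ofReal (m - ∑ i, M i) ≤ L (collarCore M p B Φ))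

/-- Sanity (the "induction" the rigidity buys, and all it buys): along a causally nested sequence
of cores the settling functional is a non-increasing sequence in `ℝ≥0∞`, hence convergent — to a
limit about which (i) says nothing. [folklore] -/
theorem LyapunovExhaustion.antitone_along_chain {α : Type} (L : Set α → ℝ≥0∞) (J : Set α → Set α)
    (hL : ∀ C C' : Set α, C' ⊆ J C → L C' ≤ L C) (C : ℕ → Set α)
    (hC : ∀ n, C (n + 1) ⊆ J (C n)) : Antitone fun n => L (C n) :=
  antitone_nat_of_succ_le fun n => hL (C n) (C (n + 1)) (hC n)

end Summit.FinalStateConjecture.FinalStateConjecture.Cruxes.GapExhaustion.StrategyS2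

end
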